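import Summits.CriticalPhenomena.PercolationContinuityZ3.Theorems.Transplant.SkelSignDropAssembly
import HarnessLib

/-!
# D″ node, the (Z″) ASSEMBLY TOP WITH STEP I′ DISCHARGED (DPRIME-SCOPE §2 L7′, addendum M.3; DPRIME-CHECKLIST DP1/DP3):
# `PlanarSkeletonSign.samePDropOfSkeletonSign_of_stepI_run` — the input family (A) of `samePDropOfSkeletonSign_of_inputs_run_subexp` IS the
# certified Step-I′ family `Skelφ.StepI.index/event/edges` of `PlanarSkeletonSign.exists_stepI` (p249048), so the instance (the constants chain +
# the three residues (R)/(F)/(C)) only has to turn the Step-I′ data `D` handed to it at the reference density `p` into admissible finite scale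
# lists `Sz Sx Sy` and, at every running density `q ∈ [p/2, p]` where that finite family holds, a run-restricted scheme with `KitAtRun`

builds on p205010 (kernel theorem, internal audit signed; external expert review pending) — nothing in this file uses p205010.
Lane `prim-bschramm`, seat `prim-bschramm-p3` (gen 7; D″ design owner); helper file (`--supports stmt-CriticalPhenomena-4575`).
The order of quantifiers is the order of constants (addendum M.3 / DP4): the instance first names the accuracy `δI > 0` and the least seed scale
`m₀` it wants (functions of its handed constants), THEN receives `D, off, M₀, n₁` with the seven Step-I′ facts (in particular `D.R = fatRadius`,
`D.Λ = fatSeqOff off`, `D.k < M₀`, `D.k < n₁`, `D.k ≤ D.Gb ℓ, D.Fb ℓ`), THEN names the finite lists (`M_u := max M₀ n₁ ∈ Sz`,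
`Sx ⊇ {M_u+1} ∪ Icc ℓ₀ ℓ₁`, … — all fixed at `p`, DP3/(r2)), and only then faces the running density `q`.
[cite: KozmaNitzan2024, §1 p. 2 (approach 1); §4 Theorem 6 (pp. 25–31), p. 17 (Step I)] [cite: Hutchcroft2016, Thm. 1] [cite: LyonsPeres2016, Thm. 7.6]
-/

noncomputable section

open MeasureTheory ProbabilityTheory
open scoped ENNReal Classical

namespace Summit.CriticalPhenomena.PercolationContinuityZ3.Theorems.Transplant

open Literature.Probability.Percolation Literature.Probability.LatticeModels SimpleGraph KNCells
open Literature.Barriers.CriticalPhenomena (HasExponentialGrowth)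

namespace PlanarSkeletonSign

/-- **THE D″ v2 ASSEMBLY TOP WITH STEP I′ DISCHARGED.**  Suppose that for every locally finite `G` NOT of exponential growth with a
`PlanarSkeletonSign Φ`, every `t ∈ Φ.types` and every density `0 < p < 1` with a.s. uniqueness, Φ2 (`hC`) and `θ_t(p) > 0`, the instance names
`δI > 0` and `m₀` and then, for all Step-I′ data `D, off, M₀, n₁` with `m₀ ≤ D.k`, `1 ≤ D.k`, `D.R = fatRadius Φ.frame hC`, `D.Λ = fatSeqOff Φ.frame hC off`,
`D.k < M₀`, `D.k < n₁`, `D.k ≤ D.Gb ℓ ∧ D.k ≤ D.Fb ℓ`, supplies finite scale lists `Sz Sx Sy` (admissible: `M₀ ≤ M ∈ Sz`, `n₁ ≤ ℓ ∈ Sx ∪ Sy`) such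
that at every `q ∈ [p/2, p]` at which every input of `StepI.index Φ.types Sz Sx Sy` has probability `> 1 − δI` and Φ2 holds there is a
run-restricted anchored-cells scheme rooted at `t` at density `q` with the six records, the constants and `KSchA.KitAtRun`.  Then
`SamePDropOfSkeletonSign`.  (Step I′ `PlanarSkeletonSign.exists_stepI` supplies (A) at `p`; `StepI.determinedBy_event` its finite-volume
character; `samePDropOfSkeletonSign_of_inputs_run_subexp` the rest.)
[cite: KozmaNitzan2024, §1 p. 2 (approach 1); §4 Theorem 6 (pp. 25–31), p. 17 (Step I)] -/
theorem samePDropOfSkeletonSign_of_stepI_run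
    (h : ∀ {V : Type} [DecidableEq V] [Countable V] (G : SimpleGraph V) [G.LocallyFinite] (Φ : PlanarSkeletonSign G),
      ¬ HasExponentialGrowth G → ∀ t ∈ Φ.types, ∀ p : unitInterval, 0 < (p : ℝ) → (p : ℝ) < 1 →
        (∀ᵐ ω ∂bondPercolation G p, numInfiniteClusters ω ≤ 1) → ∀ hC : Φ.CylSubcritical p, 0 < theta G t p →
          ∃ (δI : ℝ) (m₀ : ℕ), 0 < δI ∧
            ∀ (D : Skelφ.StepI.Data V) (off M₀ n₁ : ℕ), m₀ ≤ D.k → 1 ≤ D.k → D.R = Skelφ.fatRadius Φ.frame hC →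
              D.Λ = Skelφ.fatSeqOff Φ.frame hC off → D.k < M₀ → D.k < n₁ → (∀ ℓ, D.k ≤ D.Gb ℓ ∧ D.k ≤ D.Fb ℓ) →
              ∃ Sz Sx Sy : Finset ℕ, (∀ M ∈ Sz, M₀ ≤ M) ∧ (∀ ℓ ∈ Sx, n₁ ≤ ℓ) ∧ (∀ ℓ ∈ Sy, n₁ ≤ ℓ) ∧
                ∀ q : unitInterval, (p : ℝ) / 2 ≤ q → (q : ℝ) ≤ p →
                  (∀ i ∈ Skelφ.StepI.index Φ.types Sz Sx Sy,
                    1 - δI < (bondPercolation G q).real (Skelφ.StepI.event G Φ.φ D i)) →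
                  Φ.CylSubcritical q →
                    ∃ (A : Type) (S : KSchA V A) (FD : FaceData V A) (LD : LevelData V A) (ε' δ₂ : ℝ),
                      S.Γ.root = t ∧ S.p = q ∧
                      RunGeom G S.Γ ∧ AnchGeom S.Γ ∧ SepGeom₂ G S.Γ ∧ ExitGeom G S.Γ ∧ StepsGeom S.Γ FD ∧ LevelGeom G S.Γ FD LD ∧
                      S.δc ≤ 1 ∧ 0 ≤ ε' ∧ δ₂ ≤ 1 ∧ 4 * ((1 - δ₂) ^ S.Γ.K + ε') ≤ (1 / 2) ^ 32 ∧
                      KSchA.KitAtRun G S FD δ₂ ε') :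
    SamePDropOfSkeletonSign := by
  refine samePDropOfSkeletonSign_of_inputs_run_subexp fun {V} _ _ G _ Φ hg t ht p hp0 hp1 hU hC hθ => ?_
  obtain ⟨δI, m₀, hδI, hB⟩ := h G Φ hg t ht p hp0 hp1 hU hC hθ
  -- Step I′ at `p` with accuracy `δI` and least seed scale `m₀`
  obtain ⟨D, off, M₀, n₁, hk₀, hk₁, hR, hΛ, hM₀, hn₁, hGF, hfam⟩ := Φ.exists_stepI hg hC hθ ht hδI m₀
  obtain ⟨Sz, Sx, Sy, hSz, hSx, hSy, hq⟩ := hB D off M₀ n₁ hk₀ hk₁ hR hΛ hM₀ hn₁ hGF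
  -- (A): the Step-I′ family over the instance's finite lists
  exact ⟨Skelφ.StepI.Idx V, Skelφ.StepI.index Φ.types Sz Sx Sy, Skelφ.StepI.event G Φ.φ D, Skelφ.StepI.edges G Φ.φ D, fun _ => 1 - δI,
    fun i _ => Skelφ.StepI.determinedBy_event G Φ.φ D i, hfam Sz Sx Sy hSz hSx hSy, fun q hq1 hq2 hcq hCq => hq q hq1 hq2 hcq hCq⟩

end PlanarSkeletonSign

end Summit.CriticalPhenomena.PercolationContinuityZ3.Theorems.Transplant

end
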